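import Summits.BirchSwinnertonDyer.BirchSwinnertonDyer.Theses.SignedLowerHalves
import Summits.BirchSwinnertonDyer.Rank1Residual.Supersingular.KobayashiMainConjecture
import Summits.BirchSwinnertonDyer.Rank1Residual.Supersingular.KobayashiMainConjectureKuriharaRigidity
import Summits.BirchSwinnertonDyer.BirchSwinnertonDyer.Theorems.SignedLowerHalvesKobayashiLowerHalfLargeImageKuriharaRigidityBindersOfFacts
import Literature.NumberTheory.EllipticCurves.Rank1Residual.Typed.X7
import Literature.NumberTheory.EllipticCurves.KuriharaNumberInvariants
import Literature.NumberTheory.EllipticCurves.ModularCurvePeriodRatio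
import Literature.NumberTheory.EllipticCurves.Tamagawa
import HarnessLib

/-!
# Line `kurihara-rigidity` — crux `KobayashiLowerHalfLargeImage` (route SignedLowerHalves, item
# stmt-BirchSwinnertonDyer-19001, rank 3): Kolyvagin-system RIGIDITY turns ONE Kurihara-number
# valuation certificate into Kato's main conjecture, and Kobayashi 2003 Thm 7.4 (`a_p = 0`) turns
# Kato's main conjecture into BOTH signed main conjectures — no automorphic (Eisenstein-congruence)
# input, no condition on the conductor, hence indifferent to the additive primes that define class X7.

HONEST FRAMING (D-0152): this line feeds the CLASS route K3 = `SignedLowerHalves`; nothing here proves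
BSD; every stub is `sorry`; the composition only shows that the stubs, if proved, give the crux BY NAME.

RESHAPE r2 (lead `bsd-line-slh-p1`, 2026-08-28): the ideator's engine stub for the regime `p ∣ ∏ c_ℓ` took
`∂^(∞)(δ̃) ≤ ord_p ∏ c_ℓ` as its hypothesis, but Castella–Sano arXiv:2601.14504 Thm 1 prints the EQUALITY
`𝓜_∞(δ) = ord_p Tam_E` ⟺ IMC (p0004; proof §2.4 p0010–0011); the inequality `𝓜_∞(δ) ≥ ord_p Tam_E` (the
Euler-system direction refined by ALL Tamagawa factors) is printed only for ONE Tamagawa factor (Büyükboduk,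
JNT 129 (2009) = arXiv:0710.3858, Thm B: `κ^Kato ∈ p^n KS(T)` if `p^n ∣ c_ℓ`; the full product is his open
question; Kim AJM 2026 §1.2.6). So the engine is re-typed EXACTLY as printed (hypothesis `=`), and the `≥`
half becomes its own statement — the two halves are the tree's typed conjecture items
`X4.KimTamagawaDefectLeAt` / `X4.KimTamagawaDefectGeAt` (`Rank1Residual/X4/KimTamagawaDefect.lean`, Kim Conj 1.10)
read on the large-image corner of X7.

RESHAPE r3 = RESTUB IN «VARIANT-N» SHAPE (lead `bsd-line-slh-p1` gen 15, 2026-08-29; director-bsd (390)(1)–(3),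
registrar-of-record touch; NO mathematical content changed, NO statement of a content stub changed): every PRINT /
PREPRINT input the composition needs now enters as a conjunct of ONE of TWO declared CITE stubs, the LITERATURE
`Prop`s BY NAME inside — `stub_publishedInputs` (PUBLISHED theorems: Kim AJM 2026 Thm 1.11 (1)⇒(3) on the `η = 1`
package, Kobayashi 2003 Thm 1.2, the Greenberg–Vatsal/Mazur period transfer) and `stub_preprintInputs` (UNREFEREED
claims: Castella–Sano arXiv:2601.14504 Thm 1 (i)⇒(ii) on the package, and the `≥` reading of its §2) — and the three
r2 stubs that MIXED those inputs with no further content (`stub_signedMC_of_kuriharaPartialInfty_eq_zero` = ENGINE A,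
`stub_signedMC_of_kimTamagawaDefect` = ENGINE B, `stub_tamagawa_le_kuriharaPartialInfty_X7` = the `≥` half) become the
in-file theorems `…_closed`, each ONE application of a tree theorem landed by this line (lead cycle 1 / width seat
`-w2`): `Theorems.KuriharaRigidity.signedMC_of_kuriharaPartialInfty_eq_zero_of_facts`,
`Theorems.KuriharaRigidity.signedMC_of_kimTamagawaDefect_of_facts` (Kobayashi's Thm 7.4 (ii) at `η = 1` is PROVED in
the kernel there, `…KuriharaRigidityThm74`, not read), `Supersingular.KuriharaRigidity.tamagawa_le_kuriharaPartialInfty_X7`.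
(r3 rev a, crux commit 5fb77064eb0d, cited the COMPOSITE Summits-side binders `Kim2026_thm111_via_kobayashi74` /
`CastellaSano2026_thm1_via_kobayashi74_OPEN`; rev b replaces them by the finer LITERATURE facts they were derived from —
same print content, Kobayashi 7.4 now kernel-side.) The two CONTENT stubs are UNCHANGED, name and signature verbatim
from r2: `stub_kuriharaPartialInfty_le_tamagawa_X7` (THE HARD STUB = O1) and `stub_three` (the `p = 3` residue). The
composition `lowerHalf_of_engines` is r2's, sharpened in one point: on the rows `p ∤ ∏ c_ℓ` (t = 0) the `≥` half is
TRIVIAL (`0 ≤ ∂^(∞)`), so those rows consume the PUBLISHED cite stub and the hard stub only — the preprint cite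
stub is consumed only on the rows `p ∣ ∏ c_ℓ`.

Stubs (4 = 2 CITE-ONLY + 2 CONTENT):
* `stub_publishedInputs` — [CITE-ONLY — never a proof target, never benched, never counted] the conjunction
  `Kim2026.thm111_katoMainIdentity_of_kuriharaNumber_ne_zero ∧ Kobayashi2003.thm12_signedSelmerDual_finite_torsion ∧
  realPeriodRat_eq_unit_mul_plusPeriod` (three `Literature/…` `Prop`s transcribing PUBLISHED theorems: Kim AJM 148
  (2026) Thm 1.11 (1)⇒(3); Kobayashi Invent. 152 (2003) Thm 1.2; Mazur 1978 Cor 4.1 + Greenberg–Vatsal 2000 Rem 3.4).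
* `stub_preprintInputs` — [CITE-ONLY — PREPRINT claims, NEVER theorems; never a proof target, never benched, never
  counted] the conjunction `CastellaSano2026.thm1_katoMainIdentity_of_kimTamagawaDefect_OPEN ∧
  CastellaSano2026_sec2_tamagawaDefectGe_implicit_OPEN` ([claim: CastellaSano2026, status: under-review]; the first
  is the `Literature/…/CastellaSano2026` statement of Thm 1 (i)⇒(ii) on the package; the second is the Summits-side
  READING of §2.2–§2.4 (`Rank1Residual/Supersingular/KobayashiMainConjectureKuriharaRigidity.lean` §3) — not a
  displayed statement of the source, no Literature twin exists).
* `stub_kuriharaPartialInfty_le_tamagawa_X7` — THE HARD STUB (CONTENT, class-wide; verbatim r2): on X7 ∧ ¬CM ∧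
  `a_p = 0` ∧ surj ∧ `p ≥ 5`, the `≤` half of the refined Kurihara conjecture, `∂^(∞)(δ̃) ≤ ord_p ∏ c_ℓ`, i.e. SOME
  cyclic Kolyvagin level `n ∈ 𝒩_k`, `k ≤ t+1`, carries a Kurihara number `δ̃_n ≢ 0 (mod p^k)`, `t = ord_p ∏ c_ℓ`
  (`= X4.KimTamagawaDefectLeAt W p f`). Per pair DECIDABLE (one exact certificate); class-wide = the Eisenstein
  half of the cyclotomic IMC for non-semistable `E/ℚ` at supersingular `p ≥ 5` — OPEN IN PRINT off the Fouquet–Wan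
  locus (on the locus it is PREPRINT-closable per pair: Theorems file `…KuriharaRigidityFWCut`, not used here).
* `stub_three` — CONTENT, verbatim r2: the honest residue `p = 3` (Kim / Castella–Sano need `p > 3`). Its Kurihara
  road at 3 (Kim–Kim–Sun Thm 1.1 ∘ Ko 7.4 on the (Tam)₁ rows, flag `KKS20@3-MR-H4`) is the Theorems file
  `…KuriharaRigidityThreeEngine` (not used here).
Composition: `lowerHalf_of_engines` (explicit; `p = 3 ∨ 5 ≤ p`; at `p ≥ 5` split on `p ∣ ∏ c_ℓ`: `t = 0` ⟶ the hard
stub gives `∂^(∞) = 0` ⟶ ENGINE A (published cite stub); `t ≥ 1` ⟶ the two halves give `∂^(∞)(δ̃) = t` ⟶ ENGINE B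
(preprint cite stub)) and `KobayashiLowerHalfLargeImage_of : <the crux>` = it applied to the closed engines and the
two content stubs. READING «closed mod print»: NO — two CONTENT stubs remain (O1 class-wide at `p ≥ 5`; the `p = 3`
residue); what the cite stubs buy is exactly r2's by-name closures, now inside the registered skeleton.
-/

set_option autoImplicit false
-- single-problem summit (D-0017): the doubled namespace component is by design
set_option linter.dupNamespace false

noncomputable section

open scoped Classical MatrixGroups ModularForm

open CongruenceSubgroup WeierstrassCurve Literature.NumberTheory.EllipticCurves
  Literature.NumberTheory.EllipticCurves.ModularForms
  Literature.NumberTheory.EllipticCurves.Rank1Residual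
  Literature.NumberTheory.EllipticCurves.Rank1Residual.Typed
  Summit.BirchSwinnertonDyer.Rank1Residual.Supersingular

namespace Summit.BirchSwinnertonDyer.BirchSwinnertonDyer.Cruxes.KobayashiLowerHalfLargeImage

namespace KuriharaRigidity

/-! ### The two CITE-ONLY stubs (VARIANT-N: print / preprint inputs BY NAME, each a tree `Prop`) -/

/-- [CITE-ONLY — never a proof target, never benched, never counted] **PUBLISHED inputs of the line, by name
(three `Literature/…` statements).**
(1) `Kim2026.thm111_katoMainIdentity_of_kuriharaNumber_ne_zero` — C.-H. Kim, Amer. J. Math. 148 (2026) Thm 1.11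
(1)⇒(3) read on Kobayashi's `η = 1` signed Coleman–Kato package (`Literature/…/Kim2026/KatoMainIdentityOfUnitKuriharaNumber.lean`):
a non-zero Kurihara number mod `p` at a cyclic level ⟹ Kato's main identity, at `p ≥ 5` with `ρ̄` onto, Manin,
`E(ℚ_p)[p] = 0`, `p ∤ ∏ c_ℓ`.
(2) `Kobayashi2003.thm12_signedSelmerDual_finite_torsion` — Kobayashi, Invent. Math. 152 (2003) Thm 1.2 (`X^±`
finitely generated torsion; `Literature/…/Kobayashi2003/SignedSelmerTorsion.lean`).
(3) `realPeriodRat_eq_unit_mul_plusPeriod` — the period transfer `Ω(W) = u·Ω⁺_f`, `|u|_p = 1` at a good `p ≥ 5`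
with `E[p]` irreducible (Mazur 1978 Cor 4.1 + Greenberg–Vatsal 2000 Rem 3.4; `Literature/…/ModularCurvePeriodRatio.lean`).
Kobayashi's Thm 7.4 (ii) (Kato's identity ⟹ both signed main conjectures at `a_p = 0`) is NOT cited: it is PROVED
in the kernel on the package (`Theorems/…KuriharaRigidityThm74`, width seat `-w2`). This stub only BUNDLES the three
names so that `KobayashiLowerHalfLargeImage_of` binds no bare fact (registry rule `skeleton.extra-hypothesis`).
[cite: Kim2022StructureSelmer, Thm. 1.11 (1) ⟹ (3) (PDF p. 8)] [cite: Kobayashi2003, Thm. 1.2 (p. 2)]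
[cite: Mazur1978, Cor. 4.1] [cite: GreenbergVatsal2000, §3, Remark 3.4] -/
theorem stub_publishedInputs :
    Kim2026.thm111_katoMainIdentity_of_kuriharaNumber_ne_zero ∧
      Kobayashi2003.thm12_signedSelmerDual_finite_torsion ∧ realPeriodRat_eq_unit_mul_plusPeriod := by
  sorry

/-- [CITE-ONLY — PREPRINT claims, NEVER theorems; never a proof target, never benched, never counted]
**UNREFEREED inputs of the line, by name** ([claim: CastellaSano2026, status: under-review]; FRESHNESS
2026-08-29: arXiv:2601.14504 v1, no journal record).
(1) `CastellaSano2026.thm1_katoMainIdentity_of_kimTamagawaDefect_OPEN` — Castella–Sano Thm 1 (i)⇒(ii) on the package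
(`𝓜_∞(δ) = ord_p Tam_E` ⟹ Kato's main identity for `ℚ_∞/ℚ`; `p > 3`, non-CM, (sur), (manin);
`Literature/…/CastellaSano2026/KatoMainIdentityOfKimTamagawaDefectOPEN.lean`).
(2) `CastellaSano2026_sec2_tamagawaDefectGe_implicit_OPEN` — the Euler-system INEQUALITY `𝓜_∞(δ) ≥ ord_p Tam_E`
READ out of §2.2–§2.4 (integrality of `𝔷_{ℚ_∞}` + Prop. 2.3.1 + Thm 2.1.4 + (eq:chain); Summits-side reading binder,
`Rank1Residual/Supersingular/KobayashiMainConjectureKuriharaRigidity.lean` §3); NOT a displayed statement of the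
source (for ONE Tamagawa prime it is Büyükboduk, JNT 129 (2009) Thm B = the tree's
`Buyukboduk2009.thmB_via_kim313_padicValNat_localTamagawa_le_kuriharaPartialInfty`; for the full product it is his
open question) — a reading a referee must check (orientation of `det⁻¹` on torsion modules, Cor. 2.3.2).
Consumed ONLY on the rows `p ∣ ∏ c_ℓ` (see `lowerHalf_of_engines`). [claim: CastellaSano2026, status: under-review]
[cite: Buyukboduk2009TamagawaDefect, Thm. B (orientation)] -/
theorem stub_preprintInputs :
    CastellaSano2026.thm1_katoMainIdentity_of_kimTamagawaDefect_OPEN ∧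
      CastellaSano2026_sec2_tamagawaDefectGe_implicit_OPEN := by
  sorry

/-! ### The three r2 stubs that were PURE print/preprint inputs, now CLOSED BY NAME from the cite stubs -/

/-- **ENGINE A, closed** (r2's registered `stub_signedMC_of_kuriharaPartialInfty_eq_zero`, signature VERBATIM):
regime `p ∤ ∏ c_ℓ`; at `p ≥ 5` good with `a_p = 0` and `ρ̄` onto, `∂^{(∞)}(δ̃) = 0` for the newform ⟹ Kobayashi's main
conjecture for BOTH signs. ONE application of the tree theorem
`Theorems.KuriharaRigidity.signedMC_of_kuriharaPartialInfty_eq_zero_of_facts` (Kobayashi Thm 7.4 (ii) at `η = 1` in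
the kernel; `E(ℚ_p)[p] = 0` discharged by `natCard_localPTorsion_eq_one_of_good_of_not_dvd_frobeniusTrace_sub_one`;
`E[p]` irreducible from `ρ̄` onto; unit Kurihara number ⟺ `∂^{(∞)} = 0`) to the three conjuncts of
`stub_publishedInputs`. PUBLISHED inputs only. [cite: Kim2022StructureSelmer, Thm. 1.11 (1) ⟹ (3)]
[cite: Kobayashi2003, Thm. 7.4 (p. 13), Thm. 1.2 (p. 2)] -/
theorem signedMC_of_kuriharaPartialInfty_eq_zero_closed :
    ∀ (W : WeierstrassCurve ℚ) [W.IsElliptic] [W.IsGloballyMinimal] (p : ℕ) [Fact p.Prime],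
      5 ≤ p → W.HasGoodReductionAtPrime p → W.frobeniusTrace p = 0 → Surj W p →
      ¬ p ∣ W.tamagawaProduct →
      (∀ [NeZero (W.conductorNorm ℤ)] (f : CuspForm (Gamma0 (W.conductorNorm ℤ)) 2),
          IsNewformOf W f → kuriharaPartialInfty W p f = 0) →
      ∀ ε : ℤˣ, KobayashiMainConjecture W p ε :=
  Theorems.KuriharaRigidity.signedMC_of_kuriharaPartialInfty_eq_zero_of_facts
    stub_publishedInputs.1 stub_publishedInputs.2.1 stub_publishedInputs.2.2

/-- **ENGINE B, closed** (r2's registered `stub_signedMC_of_kimTamagawaDefect`, signature VERBATIM): any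
`t = ord_p ∏ c_ℓ`; at `p ≥ 5` good with `a_p = 0`, `E` non-CM, `ρ̄` onto, `∂^{(∞)}(δ̃) = t` EXACTLY for the newform ⟹
Kobayashi's main conjecture for both signs. ONE application of the tree theorem
`Theorems.KuriharaRigidity.signedMC_of_kimTamagawaDefect_of_facts` (Kobayashi Thm 7.4 (ii) in the kernel) to conjunct
(1) of `stub_preprintInputs` (PREPRINT, never a theorem) and conjuncts (2), (3) of `stub_publishedInputs`.
[claim: CastellaSano2026, status: under-review] [cite: Kobayashi2003, Thm. 7.4 (p. 13), Thm. 1.2 (p. 2)] -/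
theorem signedMC_of_kimTamagawaDefect_closed :
    ∀ (W : WeierstrassCurve ℚ) [W.IsElliptic] [W.IsGloballyMinimal] (p : ℕ) [Fact p.Prime],
      5 ≤ p → W.HasGoodReductionAtPrime p → W.frobeniusTrace p = 0 → ¬ W.HasCM → Surj W p →
      (∀ [NeZero (W.conductorNorm ℤ)] (f : CuspForm (Gamma0 (W.conductorNorm ℤ)) 2),
          IsNewformOf W f →
            kuriharaPartialInfty W p f = (padicValNat p W.tamagawaProduct : ℕ∞)) →
      ∀ ε : ℤˣ, KobayashiMainConjecture W p ε :=
  Theorems.KuriharaRigidity.signedMC_of_kimTamagawaDefect_of_facts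
    stub_preprintInputs.1 stub_publishedInputs.2.1 stub_publishedInputs.2.2

/-- **THE `≥` HALF, closed** (r2's registered `stub_tamagawa_le_kuriharaPartialInfty_X7`, signature VERBATIM): on
X7 ∧ ¬CM ∧ `a_p = 0` ∧ surj ∧ `p ≥ 5`, every Kurihara number of the newform at every cyclic Kolyvagin level is divisible
by `p^{min(depth, t)}` (`X4.KimTamagawaDefectGeAt`). ONE application of the tree theorem
`Supersingular.KuriharaRigidity.tamagawa_le_kuriharaPartialInfty_X7` to conjunct (2) of `stub_preprintInputs` (a
READING of a PREPRINT, never a theorem) and conjunct (3) of `stub_publishedInputs`. Trivial — and NOT consumed — on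
the rows `p ∤ ∏ c_ℓ` (`lowerHalf_of_engines`). [claim: CastellaSano2026, status: under-review]
[cite: Buyukboduk2009TamagawaDefect, Thm. B (orientation)] -/
theorem tamagawa_le_kuriharaPartialInfty_X7_closed :
    ∀ (W : WeierstrassCurve ℚ) [W.IsElliptic] [W.IsGloballyMinimal] (p : ℕ) [Fact p.Prime],
      5 ≤ p → ClassX7 W p → ¬ W.HasCM → W.frobeniusTrace p = 0 → Surj W p →
      ∀ [NeZero (W.conductorNorm ℤ)] (f : CuspForm (Gamma0 (W.conductorNorm ℤ)) 2),
        IsNewformOf W f → (padicValNat p W.tamagawaProduct : ℕ∞) ≤ kuriharaPartialInfty W p f :=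
  _root_.Summit.BirchSwinnertonDyer.Rank1Residual.Supersingular.KuriharaRigidity.tamagawa_le_kuriharaPartialInfty_X7
    stub_preprintInputs.2 stub_publishedInputs.2.2

/-! ### The two CONTENT stubs (verbatim r2) -/

/-- THE HARD STUB (CONTENT; class-wide, the `≤` half of the refined Kurihara conjecture on the large-image corner of
X7 = the tree's `X4.KimTamagawaDefectLeAt W p f` there): for `E` in class X7 at `p ≥ 5` (good supersingular,
`E` not semistable), non-CM, `a_p = 0`, `ρ̄_{E,p}` onto, and the newform `f` of `E`:
`∂^{(∞)}(δ̃) ≤ ord_p ∏ c_ℓ`. A NON-VANISHING statement about finitely many mod-`p^{t+1}` modular-symbol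
sums per level; per pair decidable. Conjectured: Kim AJM 2026 Conj 1.10, Castella–Sano Conj 2; no
reduction-type or conductor hypothesis in either. Class-wide it is (modulo the named inputs, Theorems file
`…KuriharaRigidityEquivalence`) EQUIVALENT to the crux at `p ≥ 5`: the Eisenstein half of the cyclotomic main
conjecture for non-semistable `E/ℚ` at supersingular `p` — OPEN IN PRINT off the Fouquet–Wan locus. Name and
signature UNCHANGED from r2 (registered 2026-08-28). -/
theorem stub_kuriharaPartialInfty_le_tamagawa_X7 :
    ∀ (W : WeierstrassCurve ℚ) [W.IsElliptic] [W.IsGloballyMinimal] (p : ℕ) [Fact p.Prime],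
      5 ≤ p → ClassX7 W p → ¬ W.HasCM → W.frobeniusTrace p = 0 → Surj W p →
      ∀ [NeZero (W.conductorNorm ℤ)] (f : CuspForm (Gamma0 (W.conductorNorm ℤ)) 2),
        IsNewformOf W f → kuriharaPartialInfty W p f ≤ (padicValNat p W.tamagawaProduct : ℕ∞) := by
  sorry

/-- RESIDUE `p = 3` (CONTENT; honest; verbatim r2): the crux's conclusion at the prime `3` (X7 with `a_3 = 0`,
large image). The rigidity engines above are printed for `p > 3` only (Mazur–Rubin's Chebotarev hypotheses; Kim
Thm 1.11; Castella–Sano Thm 1); the Kurihara road at 3 (Kim–Kim–Sun, Selecta 2020 Thm 1.1, printed for `p > 2`,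
flag `KKS20@3-MR-H4`, on the (Tam)₁ rows with `3 ∤ ∏ c_ℓ`) reduces it to Kurihara's conjecture at 3 there plus the
crux verbatim elsewhere (Theorems files `…KuriharaRigidityThreeEngine` / `…ThreeFW`). Name and signature UNCHANGED
from r2 (registered 2026-08-28). -/
theorem stub_three :
    ∀ (W : WeierstrassCurve ℚ) [W.IsElliptic] [W.IsGloballyMinimal] (p : ℕ) [Fact p.Prime],
      p = 3 → ClassX7 W p → ¬ W.HasCM → W.frobeniusTrace p = 0 → Surj W p →
      ∃ ε : ℤˣ, KobayashiLowerDivisibility W p ε := by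
  sorry

/-! ### Composition -/

/-- COMPOSITION, explicit form (bookkeeping; conclusion = the crux UNFOLDED, so that the only theorem concluding the
crux BY NAME is `KobayashiLowerHalfLargeImage_of` below): from the statements of ENGINE A, ENGINE B, the `≤` half
(hard stub), the `≥` half and the `p = 3` residue, an odd prime is `3` or `≥ 5`; at `p ≥ 5`, if `p ∤ ∏ c_ℓ` the `≤` half
ALONE gives `∂^(∞)(δ̃) = 0` (`≤ 0`), which ENGINE A (published inputs) turns into Kobayashi's main conjecture for every
sign; if `p ∣ ∏ c_ℓ` the two halves give `∂^(∞)(δ̃) = ord_p ∏ c_ℓ`, which ENGINE B (preprint input) turns into the same;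
whence the Eisenstein half for the sign `+1` (`kobayashiLowerDivisibility_of_mainConjecture`). r3 sharpening over r2:
the `≥` half `hGe` is used only in the branch `p ∣ ∏ c_ℓ`. -/
theorem lowerHalf_of_engines
    (hA : ∀ (W : WeierstrassCurve ℚ) [W.IsElliptic] [W.IsGloballyMinimal] (p : ℕ) [Fact p.Prime],
      5 ≤ p → W.HasGoodReductionAtPrime p → W.frobeniusTrace p = 0 → Surj W p →
      ¬ p ∣ W.tamagawaProduct →
      (∀ [NeZero (W.conductorNorm ℤ)] (f : CuspForm (Gamma0 (W.conductorNorm ℤ)) 2),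
          IsNewformOf W f → kuriharaPartialInfty W p f = 0) →
      ∀ ε : ℤˣ, KobayashiMainConjecture W p ε)
    (hB : ∀ (W : WeierstrassCurve ℚ) [W.IsElliptic] [W.IsGloballyMinimal] (p : ℕ) [Fact p.Prime],
      5 ≤ p → W.HasGoodReductionAtPrime p → W.frobeniusTrace p = 0 → ¬ W.HasCM → Surj W p →
      (∀ [NeZero (W.conductorNorm ℤ)] (f : CuspForm (Gamma0 (W.conductorNorm ℤ)) 2),
          IsNewformOf W f →
            kuriharaPartialInfty W p f = (padicValNat p W.tamagawaProduct : ℕ∞)) →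
      ∀ ε : ℤˣ, KobayashiMainConjecture W p ε)
    (hLe : ∀ (W : WeierstrassCurve ℚ) [W.IsElliptic] [W.IsGloballyMinimal] (p : ℕ) [Fact p.Prime],
      5 ≤ p → ClassX7 W p → ¬ W.HasCM → W.frobeniusTrace p = 0 → Surj W p →
      ∀ [NeZero (W.conductorNorm ℤ)] (f : CuspForm (Gamma0 (W.conductorNorm ℤ)) 2),
        IsNewformOf W f → kuriharaPartialInfty W p f ≤ (padicValNat p W.tamagawaProduct : ℕ∞))
    (hGe : ∀ (W : WeierstrassCurve ℚ) [W.IsElliptic] [W.IsGloballyMinimal] (p : ℕ) [Fact p.Prime],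
      5 ≤ p → ClassX7 W p → ¬ W.HasCM → W.frobeniusTrace p = 0 → Surj W p →
      ∀ [NeZero (W.conductorNorm ℤ)] (f : CuspForm (Gamma0 (W.conductorNorm ℤ)) 2),
        IsNewformOf W f → (padicValNat p W.tamagawaProduct : ℕ∞) ≤ kuriharaPartialInfty W p f)
    (h3 : ∀ (W : WeierstrassCurve ℚ) [W.IsElliptic] [W.IsGloballyMinimal] (p : ℕ) [Fact p.Prime],
      p = 3 → ClassX7 W p → ¬ W.HasCM → W.frobeniusTrace p = 0 → Surj W p →
      ∃ ε : ℤˣ, KobayashiLowerDivisibility W p ε) :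
    ∀ (W : WeierstrassCurve ℚ) [W.IsElliptic] [W.IsGloballyMinimal] (p : ℕ) [Fact p.Prime],
      p ≠ 2 → ClassX7 W p → ¬ W.HasCM → W.frobeniusTrace p = 0 → Surj W p →
      ∃ ε : ℤˣ, KobayashiLowerDivisibility W p ε := by
  intro W _ _ p _ hp2 hX hcm hap hs
  have hpP : p.Prime := Fact.out
  by_cases hp5 : 5 ≤ p
  · by_cases htam : p ∣ W.tamagawaProduct
    · have heq : ∀ [NeZero (W.conductorNorm ℤ)] (f : CuspForm (Gamma0 (W.conductorNorm ℤ)) 2),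
          IsNewformOf W f →
            kuriharaPartialInfty W p f = (padicValNat p W.tamagawaProduct : ℕ∞) :=
        fun f hf => le_antisymm (hLe W p hp5 hX hcm hap hs f hf) (hGe W p hp5 hX hcm hap hs f hf)
      exact ⟨1, kobayashiLowerDivisibility_of_mainConjecture
        (hB W p hp5 hX.1.1 hap hcm hs (fun f hf => heq f hf) 1)⟩
    · have ht0 : padicValNat p W.tamagawaProduct = 0 :=
        padicValNat.eq_zero_of_not_dvd htam
      refine ⟨1, kobayashiLowerDivisibility_of_mainConjecture
        (hA W p hp5 hX.1.1 hap hs htam (fun f hf => ?_) 1)⟩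
      have h := hLe W p hp5 hX hcm hap hs f hf
      rw [ht0] at h
      exact_mod_cast nonpos_iff_eq_zero.mp h
  · have hp3 : p = 3 := by
      have h2 := hpP.two_le
      interval_cases p
      · exact absurd rfl hp2
      · rfl
      · exact absurd hpP (by decide)
    exact h3 W p hp3 hX hcm hap hs

/-- THE SKELETON: the crux BY NAME from exactly the four registered stubs — the two CITE stubs through the three
closed r2 statements (`…_closed`), and the two CONTENT stubs (no sorry of its own; the stubs' `sorry`s are the
line's open obligations: print/preprint inputs by name, O1, the `p = 3` residue). -/
theorem KobayashiLowerHalfLargeImage_of :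
    Summit.BirchSwinnertonDyer.BirchSwinnertonDyer.Theses.SignedLowerHalves.KobayashiLowerHalfLargeImage :=
  lowerHalf_of_engines signedMC_of_kuriharaPartialInfty_eq_zero_closed
    signedMC_of_kimTamagawaDefect_closed stub_kuriharaPartialInfty_le_tamagawa_X7
    tamagawa_le_kuriharaPartialInfty_X7_closed stub_three

end KuriharaRigidity

end Summit.BirchSwinnertonDyer.BirchSwinnertonDyer.Cruxes.KobayashiLowerHalfLargeImage
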